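import Summits.CriticalPhenomena.PercolationContinuityZ3.Theorems.PercNearOneGluingNoHeavyQuantTorqueCost
import Summits.CriticalPhenomena.PercolationContinuityZ3.Theorems.PercNearOneGluingNoHeavyQuantGatedConvSplit
import HarnessLib

/-!
# QUANT lane R8, T-DEC: ONE NEAR ROUTE PER LOW ATOM — a layer-free, gate-uniform SDEC certificate, and the k-GENERAL progression criterion
# behind every sub-floor hub `δ_j ∗ Π_{i<j} blob₂(γᵢ)` (census-1 gen 31)

builds on p205010 (kernel theorem, internal audit signed; external expert review pending)

Support file (`--supports stmt-CriticalPhenomena-4575`), QUANT lane seat prim-quant-census-1 (gen 31); memo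
`run/shared/lean/prim/quant/prim-quant-census-1/g31/HUB-GENERAL-G31.md`.  Theorems only (no definitions), standard axioms, no sorries.  Tools: arm-1 g50's torque-cost criterion in its cost-free form `flowAtT_of_safeTransport`
(`…QuantTorqueCost`), the flow normal form (`decAtT_of_flowAtT`, typer g22), `gate_laws` / `gate_apply` / `sum_mul_gate`.

WHY.  Census-1 g30 closed the sub-floor hubs of 2, 3, 4 far-giant pieces `C(γ) = {1: 1−γ, 3: γ}` (`sdec_pairHub`, `sdec_tripleHub`, `sdec_quadHub`)
by ONE explicit near route per outer gate, found hub by hub.  The k-general object — `C-hub_j = δ_j ∗ Π_{i<j} blob₂(γᵢ)`, the all-far-giant core of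
EVERY forest of `j` glued children / `j` 3-chains — has up to `⌈j/4⌉` positive low atoms after a gate.  THIS FILE isolates the two k-general facts:

* **`sdec_of_nearRoutes`** (generic).  A probability law `μ` on `{0..M}` with mean `T₀ > 0`, floor `0 < x < 1`, `x·M ≤ T₀`, is SDEC as soon as there
  is a ROUTE MAP `t : ℝ → ℕ → ℕ` giving, for every target `0 < T ≤ T₀` (`T = a·T₀` is the mean after the gate `a`) and every charged positive low atom
  `l` (`1 ≤ l`, `2l < T`, `μ l > 0`), an absorber `h = t T l` with `l < h < T < l + h` (a NEAR absorber: self-sufficient, compatible, cost-free),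
  injective in `l`, and the capacity inequality `max(x, (T−2l)/(h−l))·(μ l + μ h) ≤ μ h`.  Proof: at gate `a` ship `gate μ a l = a·μ l` through the
  pair `{l, h; max(ax, ρ)}` (valid at EVERY layer), capacities scale by `a`, the zero atom rides the torque (`flowAtT_of_safeTransport`).
* **`sdec_progression`** (the criterion).  `j ≥ 4`; `μ` a probability law on `{0..3j}` with no atom below `j`, mean `T₀ < 3j`, floor `x` with
  `3jx ≤ T₀`; a constant `R ≥ 2` with `x(1+R) ≤ R`; and the ROUTE BOUND `R·μ l ≤ μ (l + 2r)` for every charged `l` with `2l < T₀` and every `r ≥ 1`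
  with `4(r−1) < 3(T₀ − 2l)`.  Then `SDEC x (3j) μ`.  The route map is **`l ↦ l + 2⌈3(T−2l)/4⌉`** (`nearTarget_lt`): minimal credit gate `ρ ≤ 2/3`,
  `h < T` because `l ≥ j ≥ 4` and `T < 3j`, strictly decreasing in `l` (hence injective), and the capacity follows from the route bound
  (`x`-part: `x(1+R) ≤ R`; `ρ`-part: `R ≥ 2`).
The instance (census-1 g31, `…QuantSubfloorHubGeneral`): for `C-hub_j` with `1/2 ≤ γᵢ < 1`, `3x ≤ 1 + 2γᵢ`, the route bound holds with
`R = 2·min odds` by likelihood-ratio dominance over `Bin(j, 1/2)` and unimodality of the binomial coefficients.  EXACT CENSUS (memo §1): the certificate's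
five claims verified on 883 000 (hub, gate) instances, `j = 4..9`, incl. the near-sure corner; 0 failures.

HONEST STATUS.  Certificate infrastructure + a sufficient criterion; `SiblingStep`, `GluedDominated`, `SDECConvClosed`, `FarTreeRow` OPEN; RATE class
(log\*) / honest sentence of `run/shared/lean/prim/quant/README.md` unchanged.  [this work].  Transportation with gains is classical; nothing here is
cited as a published result.  The gluing rows served [cite: KozmaNitzan2024, Conjecture 3 (p. 15)]; product measure [cite: Grimmett1999, §1.3 p. 10].
-/

noncomputable section

open scoped BigOperators

namespace Summit.CriticalPhenomena.PercolationContinuityZ3.Theorems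
namespace Quant
namespace LawDec

open Finset

/-! ### One algebraic step -/

/-- capacity of one route: `θ < 1`, `θ·(A + B) ≤ B` ⟹ `θ/(1−θ)·A ≤ B`. [this work] -/
private theorem rate_mul_le {θ A B : ℝ} (hθ1 : θ < 1) (h : θ * (A + B) ≤ B) : θ / (1 - θ) * A ≤ B := by
  rw [div_mul_eq_mul_div, div_le_iff₀ (by linarith)]
  linarith

/-- the mean of a probability law on `{0..M}` is at most `M` (as in `Quant.mean_le_top`). [this work] -/
private theorem mean_le_top_law (M : ℕ) (μ : ℕ → ℝ) (hμ0 : ∀ h, 0 ≤ μ h) (hμ1 : ∑ h ∈ Finset.range (M + 1), μ h = 1) :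
    ∑ h ∈ Finset.range (M + 1), (h : ℝ) * μ h ≤ M := by
  calc ∑ h ∈ Finset.range (M + 1), (h : ℝ) * μ h ≤ ∑ h ∈ Finset.range (M + 1), (M : ℝ) * μ h := by
        refine Finset.sum_le_sum fun h hh => ?_
        have : (h : ℝ) ≤ M := by exact_mod_cast Nat.lt_succ_iff.1 (Finset.mem_range.1 hh)
        exact mul_le_mul_of_nonneg_right this (hμ0 h)
    _ = M := by rw [← Finset.mul_sum, hμ1, mul_one]

/-! ### One near route per low atom -/

/-- **ONE NEAR ROUTE PER LOW ATOM ⟹ SDEC.**  `μ` a probability law on `{0..M}` with mean `T₀ > 0`, floor `0 < x < 1`, `x·M ≤ T₀`; a route map `t`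
such that for every target `0 < T ≤ T₀` and every charged positive low `l` (`1 ≤ l`, `2l < T`, `0 < μ l`) the absorber `h = t T l` satisfies
`l < h`, `h < T`, `T < l + h` and `max(x, (T−2l)/(h−l))·(μ l + μ h) ≤ μ h`, and `t T` is injective on the positive lows of `T`.  Then `SDEC x M μ`.
[this work] -/
theorem sdec_of_nearRoutes (x T₀ : ℝ) (M : ℕ) (μ : ℕ → ℝ) (t : ℝ → ℕ → ℕ) (hx0 : 0 < x) (hx1 : x < 1)
    (hμ0 : ∀ h, 0 ≤ μ h) (hμM : ∀ h, M < h → μ h = 0) (hμ1 : ∑ h ∈ Finset.range (M + 1), μ h = 1)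
    (hT : ∑ h ∈ Finset.range (M + 1), (h : ℝ) * μ h = T₀) (hT0 : 0 < T₀) (hta : x * (M : ℝ) ≤ T₀)
    (hroute : ∀ T : ℝ, 0 < T → T ≤ T₀ → ∀ l : ℕ, 1 ≤ l → 2 * (l : ℝ) < T → 0 < μ l →
      l < t T l ∧ ((t T l : ℕ) : ℝ) < T ∧ T < (l : ℝ) + (t T l : ℕ) ∧
      max x ((T - 2 * (l : ℝ)) / (((t T l : ℕ) : ℝ) - l)) * (μ l + μ (t T l)) ≤ μ (t T l))
    (hinj : ∀ T : ℝ, 0 < T → T ≤ T₀ → ∀ l l' : ℕ, 1 ≤ l → 2 * (l : ℝ) < T → 1 ≤ l' → 2 * (l' : ℝ) < T →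
      t T l = t T l' → l = l') :
    SDEC x M μ := by
  classical
  have hTM : T₀ ≤ M := by rw [← hT]; exact mean_le_top_law M μ hμ0 hμ1
  intro a ha0 ha1 j' hj'
  obtain ⟨g0, gM, g1⟩ := gate_laws M μ a ha0.le ha1 hμ0 hμM hμ1
  have gmean : ∑ h ∈ Finset.range (M + 1), (h : ℝ) * gate μ a h = a * T₀ := by rw [sum_mul_gate, hT]
  have gpos : ∀ h : ℕ, h ≠ 0 → gate μ a h = a * μ h := fun h hh => by
    rw [gate_apply, if_neg hh, mul_zero, add_zero]
  set T : ℝ := a * T₀ with hTdef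
  set y : ℝ := a * x with hydef
  have hy0 : 0 < y := mul_pos ha0 hx0
  have hyx : y ≤ x := by
    have := mul_le_mul_of_nonneg_right ha1 hx0.le
    rwa [one_mul] at this
  have hy1 : y < 1 := lt_of_le_of_lt hyx hx1
  have hTpos : 0 < T := mul_pos ha0 hT0
  have hTle : T ≤ T₀ := by
    have := mul_le_mul_of_nonneg_right ha1 hT0.le
    rwa [one_mul] at this
  have hta' : y * (M : ℝ) ≤ T := by
    have := mul_le_mul_of_nonneg_left hta ha0.le
    rw [hydef, hTdef, mul_assoc]; exact this
  rw [decAt_iff_decAtT, gmean]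
  refine decAtT_of_flowAtT y T j' M (gate μ a) hy0 hy1 gM g1 ?_
  -- the transport: every charged positive low `l` ships its whole mass to `t T l`
  refine flowAtT_of_safeTransport y T j' M (gate μ a)
    (fun l h => if (1 ≤ l ∧ 2 * (l : ℝ) < T ∧ h = t T l) then gate μ a l else 0)
    hy0 hy1 hTpos hj' g0 gM hta' (by rw [g1, gmean, mul_one]) ?_ ?_ ?_ ?_
  · -- nonnegativity
    intro l h
    show (0:ℝ) ≤ (if (1 ≤ l ∧ 2 * (l : ℝ) < T ∧ h = t T l) then gate μ a l else 0)
    split_ifs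
    · exact g0 l
    · exact le_rfl
  · -- support: near, compatible, cost-free routes
    intro l h hp
    change (0:ℝ) < (if (1 ≤ l ∧ 2 * (l : ℝ) < T ∧ h = t T l) then gate μ a l else 0) at hp
    split_ifs at hp with hc
    · obtain ⟨hl1, hlT, rfl⟩ := hc
      have hl0 : l ≠ 0 := by omega
      rw [gpos l hl0] at hp
      have hμl : 0 < μ l := pos_of_mul_pos_right hp ha0.le
      obtain ⟨hlt, htT, hTlt, _⟩ := hroute T hTpos hTle l hl1 hlT hμl
      have htM : t T l ≤ M := by
        have : ((t T l : ℕ) : ℝ) < M := by linarith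
        exact_mod_cast this.le
      refine ⟨hl1, hlT, hlt, htM, hTlt, ?_⟩
      have hd : (0 : ℝ) ≤ ((t T l : ℕ) : ℝ) - l := by
        have : (l : ℝ) ≤ (t T l : ℕ) := by exact_mod_cast hlt.le
        linarith
      calc y * (((t T l : ℕ) : ℝ) - l) ≤ 1 * (((t T l : ℕ) : ℝ) - l) := mul_le_mul_of_nonneg_right hy1.le hd
        _ ≤ T - l := by linarith
    · exact absurd hp (lt_irrefl _)
  · -- rows: every positive low is shipped exactly
    intro l hl1 hlT
    have hl0 : l ≠ 0 := by omega
    have e : ∀ h, (if (1 ≤ l ∧ 2 * (l : ℝ) < T ∧ h = t T l) then gate μ a l else 0)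
        = (if h = t T l then gate μ a l else 0) := fun h => by simp only [hl1, hlT, true_and]
    simp_rw [e]
    rw [Finset.sum_ite_eq']
    rcases (hμ0 l).eq_or_lt with hz | hpos
    · rw [gpos l hl0, ← hz, mul_zero]; split_ifs <;> rfl
    · obtain ⟨hlt, htT, _, _⟩ := hroute T hTpos hTle l hl1 hlT hpos
      have htM : t T l < M + 1 := by
        have : ((t T l : ℕ) : ℝ) < M + 1 := by linarith
        exact_mod_cast this
      rw [if_pos (Finset.mem_range.2 htM)]
  · -- capacities: at most one low per absorber (injectivity), then the capacity inequality
    intro h hhM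
    by_cases hex : ∃ l : ℕ, 1 ≤ l ∧ 2 * (l : ℝ) < T ∧ h = t T l ∧ 0 < μ l
    · obtain ⟨l₀, hl1, hlT, rfl, hμl⟩ := hex
      obtain ⟨hlt, htT, hTlt, hcap⟩ := hroute T hTpos hTle l₀ hl1 hlT hμl
      have hl₀M : l₀ ∈ Finset.range (M + 1) := by
        refine Finset.mem_range.2 ?_
        have : ((l₀ : ℕ) : ℝ) < M + 1 := by
          have : (l₀ : ℝ) < (t T l₀ : ℕ) := by exact_mod_cast hlt
          linarith
        exact_mod_cast this
      rw [Finset.sum_eq_single_of_mem l₀ hl₀M]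
      · simp only [hl1, hlT, true_and, if_true]
        -- the rate against the capacity
        have hd : (0 : ℝ) < ((t T l₀ : ℕ) : ℝ) - l₀ := by
          have : (l₀ : ℝ) < (t T l₀ : ℕ) := by exact_mod_cast hlt
          linarith
        set ρ : ℝ := (T - 2 * (l₀ : ℝ)) / (((t T l₀ : ℕ) : ℝ) - l₀) with hρ
        have hρ1 : ρ < 1 := by rw [hρ, div_lt_one hd]; linarith
        have hθ1 : max y ρ < 1 := max_lt hy1 hρ1
        have hS : 0 ≤ μ l₀ + μ (t T l₀) := add_nonneg (hμ0 _) (hμ0 _)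
        have h1 : max y ρ * (μ l₀ + μ (t T l₀)) ≤ μ (t T l₀) :=
          (mul_le_mul_of_nonneg_right (max_le_max hyx le_rfl) hS).trans hcap
        have ht0 : t T l₀ ≠ 0 := by omega
        have h2 : max y ρ * (gate μ a l₀ + gate μ a (t T l₀)) ≤ gate μ a (t T l₀) := by
          rw [gpos l₀ (by omega), gpos _ ht0]
          have := mul_le_mul_of_nonneg_left h1 ha0.le
          have e : max y ρ * (a * μ l₀ + a * μ (t T l₀)) = a * (max y ρ * (μ l₀ + μ (t T l₀))) := by ring
          rw [e]; exact this
        unfold freeRate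
        exact rate_mul_le hθ1 h2
      · intro l hl hne
        split_ifs with hc
        · exfalso
          exact hne (hinj T hTpos hTle l l₀ hc.1 hc.2.1 hl1 hlT hc.2.2.symm)
        · rw [mul_zero]
    · -- no charged low routes to `h`
      have hz : ∀ l ∈ Finset.range (M + 1),
          freeRate y T l h * (if (1 ≤ l ∧ 2 * (l : ℝ) < T ∧ h = t T l) then gate μ a l else 0) = 0 := by
        intro l _
        split_ifs with hc
        · have hl0 : l ≠ 0 := by omega
          rcases (hμ0 l).eq_or_lt with hzl | hpos
          · rw [gpos l hl0, ← hzl, mul_zero, mul_zero]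
          · exact absurd ⟨l, hc.1, hc.2.1, hc.2.2, hpos⟩ hex
        · rw [mul_zero]
      rw [Finset.sum_congr rfl hz, Finset.sum_const_zero]
      exact g0 h

/-! ### The progression criterion -/

/-- **the route map of the progression criterion** — at target `T` the positive low `l` ships to `l + 2⌈3(T − 2l)/4⌉` (the nearest atom of
the progression `l + 2ℕ` whose credit gate `(T − 2l)/(h − l)` is at most `2/3`) — is strictly decreasing on the positive lows of `T`
(hence injective). [this work] -/
theorem nearTarget_lt (T : ℝ) (l l' : ℕ) (hlT' : 2 * (l' : ℝ) < T) (hll : l < l') :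
    l' + 2 * ⌈3 * (T - 2 * (l' : ℝ)) / 4⌉₊ < l + 2 * ⌈3 * (T - 2 * (l : ℝ)) / 4⌉₊ := by
  set A : ℝ := 3 * (T - 2 * (l : ℝ)) / 4 with hA
  set A' : ℝ := 3 * (T - 2 * (l' : ℝ)) / 4 with hA'
  have hd1 : (1 : ℝ) ≤ (l' : ℝ) - l := by
    have : l + 1 ≤ l' := hll
    have : (l : ℝ) + 1 ≤ l' := by exact_mod_cast this
    linarith
  have hA'0 : 0 ≤ A' := by rw [hA']; linarith
  have h1 : (⌈A'⌉₊ : ℝ) < A' + 1 := Nat.ceil_lt_add_one hA'0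
  have h2 : A ≤ ⌈A⌉₊ := Nat.le_ceil A
  have hAA : A' = A - 3 / 2 * ((l' : ℝ) - l) := by rw [hA, hA']; ring
  have key : ⌈A'⌉₊ + (l' - l) ≤ ⌈A⌉₊ := by
    by_contra hc
    have hc' : ⌈A⌉₊ + 1 ≤ ⌈A'⌉₊ + (l' - l) := Nat.succ_le_of_lt (not_le.1 hc)
    have e : ((l' - l : ℕ) : ℝ) = (l' : ℝ) - l := by rw [Nat.cast_sub hll.le]
    have : (⌈A⌉₊ : ℝ) + 1 ≤ ⌈A'⌉₊ + ((l' : ℝ) - l) := by rw [← e]; exact_mod_cast hc'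
    linarith
  omega

/-- the capacity of one route from the route bound: `R ≥ 2`, `x(1+R) ≤ R`, `ρ ≤ 2/3`, `R·A ≤ B` ⟹ `max(x, ρ)·(A + B) ≤ B`. [this work] -/
theorem cap_of_routeBound {x R ρ A B : ℝ} (hx0 : 0 ≤ x) (hR2 : 2 ≤ R) (hxR : x * (1 + R) ≤ R) (hρ : ρ ≤ 2 / 3)
    (hA : 0 ≤ A) (hB : 0 ≤ B) (hb : R * A ≤ B) : max x ρ * (A + B) ≤ B := by
  rw [max_mul_of_nonneg _ _ (add_nonneg hA hB)]
  refine max_le ?_ ?_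
  · have h1 : x * (R * A) ≤ x * B := mul_le_mul_of_nonneg_left hb hx0
    have h2 : x * (1 + R) * B ≤ R * B := mul_le_mul_of_nonneg_right hxR hB
    have hR0 : 0 < R := by linarith
    have : R * (x * (A + B)) ≤ R * B := by nlinarith
    exact le_of_mul_le_mul_left this hR0
  · have : ρ * (A + B) ≤ 2 / 3 * (A + B) := mul_le_mul_of_nonneg_right hρ (add_nonneg hA hB)
    nlinarith

/-- **THE PROGRESSION CRITERION.**  `j ≥ 4`; `μ` a probability law on `{0..3j}` with no atom below `j` and mean `T₀ < 3j`; floor `0 < x < 1` with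
`x·3j ≤ T₀`; a constant `R ≥ 2` with `x(1+R) ≤ R`; ROUTE BOUND: `R·μ l ≤ μ (l + 2r)` for every charged `l ≥ 1` with `2l < T₀` and every `r ≥ 1` with
`4(r − 1) < 3(T₀ − 2l)`.  Then `SDEC x (3j) μ` — by `sdec_of_nearRoutes` with the route map `l ↦ l + 2⌈3(T − 2l)/4⌉` (`nearTarget_lt`,
`cap_of_routeBound`). [this work] -/
theorem sdec_progression (x T₀ R : ℝ) (j : ℕ) (μ : ℕ → ℝ) (hj : 4 ≤ j) (hx0 : 0 < x) (hx1 : x < 1)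
    (hμ0 : ∀ h, 0 ≤ μ h) (hμM : ∀ h, 3 * j < h → μ h = 0) (hμ1 : ∑ h ∈ Finset.range (3 * j + 1), μ h = 1)
    (hT : ∑ h ∈ Finset.range (3 * j + 1), (h : ℝ) * μ h = T₀) (hT0 : 0 < T₀) (hT3 : T₀ < 3 * (j : ℝ))
    (hta : x * ((3 * j : ℕ) : ℝ) ≤ T₀) (hbot : ∀ h, h < j → μ h = 0) (hR2 : 2 ≤ R) (hxR : x * (1 + R) ≤ R)
    (hbound : ∀ l r : ℕ, 1 ≤ l → 2 * (l : ℝ) < T₀ → 0 < μ l → 1 ≤ r → 4 * ((r : ℝ) - 1) < 3 * (T₀ - 2 * (l : ℝ)) →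
      R * μ l ≤ μ (l + 2 * r)) :
    SDEC x (3 * j) μ := by
  refine sdec_of_nearRoutes x T₀ (3 * j) μ (fun T l => l + 2 * ⌈3 * (T - 2 * (l : ℝ)) / 4⌉₊) hx0 hx1 hμ0 hμM hμ1 hT hT0 hta ?_ ?_
  · intro T hTpos hTle l hl1 hlT hμl
    have hlj : j ≤ l := by
      by_contra h
      exact absurd (hbot l (not_le.1 h)) hμl.ne'
    have hl4 : (4 : ℝ) ≤ l := by exact_mod_cast hj.trans hlj
    have hjl : (j : ℝ) ≤ l := by exact_mod_cast hlj
    set A : ℝ := 3 * (T - 2 * (l : ℝ)) / 4 with hA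
    have hA0 : 0 < A := by rw [hA]; linarith
    set r : ℕ := ⌈A⌉₊ with hr
    have hrA : A ≤ r := Nat.le_ceil A
    have hrA1 : (r : ℝ) < A + 1 := Nat.ceil_lt_add_one hA0.le
    have hr1 : 1 ≤ r := Nat.ceil_pos.2 hA0
    have hD : T - 2 * (l : ℝ) < 2 * l - 4 := by linarith
    show l < l + 2 * r ∧ ((l + 2 * r : ℕ) : ℝ) < T ∧ T < (l : ℝ) + ((l + 2 * r : ℕ) : ℝ) ∧
      max x ((T - 2 * (l : ℝ)) / (((l + 2 * r : ℕ) : ℝ) - l)) * (μ l + μ (l + 2 * r)) ≤ μ (l + 2 * r)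
    have ec : ((l + 2 * r : ℕ) : ℝ) = (l : ℝ) + 2 * r := by push_cast; ring
    refine ⟨by omega, ?_, ?_, ?_⟩
    · rw [ec]; linarith
    · rw [ec]; linarith
    · have ed : ((l + 2 * r : ℕ) : ℝ) - l = 2 * r := by rw [ec]; ring
      rw [ed]
      have hr0 : (0 : ℝ) < 2 * r := by
        have : (1 : ℝ) ≤ r := by exact_mod_cast hr1
        linarith
      have hρ : (T - 2 * (l : ℝ)) / (2 * r) ≤ 2 / 3 := by
        rw [div_le_iff₀ hr0]; linarith
      have hb : R * μ l ≤ μ (l + 2 * r) :=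
        hbound l r hl1 (by linarith) hμl hr1 (by linarith)
      exact cap_of_routeBound hx0.le hR2 hxR hρ (hμ0 l) (hμ0 _) hb
  · intro T _ _ l l' _ hlT _ hlT' heq
    rcases lt_trichotomy l l' with h | h | h
    · exact absurd heq (nearTarget_lt T l l' hlT' h).ne'
    · exact h
    · exact absurd heq (nearTarget_lt T l' l hlT h).ne

end LawDec
end Quant
end Summit.CriticalPhenomena.PercolationContinuityZ3.Theorems
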